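import Literature.AnabelianGeometry.AbsoluteAnabelian.DiagramUniversalFamilies
import Literature.AnabelianGeometry.AbsoluteAnabelian.DiagramTelecores

/-!
# Cores and telecores from structure functors ([AbsTopIII] Def. 3.5 (iii)–(iv), toolkit III)

S. Mochizuki, *Topics in Absolute Anabelian Geometry III*, Def. 3.5 (iii)–(iv) pp. 75–76 (manuscript
`paper:url-5493eb38cbb7`, bib key `MochizukiAbsTopIII2015`).  Continuation of
`DiagramUniversalFamilies.lean`.  Given structure functors `(N, μ)` on `𝒟` over `𝒞` (`OverData`),
an observable shape `𝒮 = 𝒟 ∪ {v_𝒮}` whose observation functors lie over `𝒞` through a FULLY FAITHFUL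
`N_{v_𝒮}`, and telecore edges `v_𝒮 → v` whose functors lie over `𝒞` as well, this file assembles:

* structure functors on the extended diagrams `𝒮` and `𝒯` (`OverData.extendOver`);
* the **core** `(𝒮, v_𝒮, ℋ)` with `ℋ` the universal family for `W = {v_𝒮}` (`univCoreObs`,
  `univCoreObs_isCore` — Def. 3.5 (iii): all co-verticial pairs into `v_𝒮`);
* the **telecore** `𝒯` over it (Def. 3.5 (iv)): telecore family `𝒥` = the universal family of `𝒯`
  (for any `W ∋ v_𝒮` of fully faithful vertices) restricted to the pairs `([γ₃]∘[γ₁], [γ₃]∘[γ₂])`,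
  with `𝒥|_𝒮 = ℋ` PROVED (`univTelecore`; the comparison of lifts along the graph inclusion
  `Γ⃗_𝒮 ↪ Γ⃗_𝒯` is `lift_heq_telecoreInclusion`);
* every restriction of the universal family of `𝒯` is a **contact structure** for this telecore
  (`isContactStructure_restrictBoundary`, Def. 3.5 (iv): compatible with `𝒥`).

Consumer: `AbsTopIII/FrobeniusPictureMLFTelecoreProofs.lean` (Cor. 3.6 (ii) = Cor. 4.5 (ii)).
Pure category theory; no claim of the paper is asserted.
-/

namespace Literature.AnabelianGeometry.AbsoluteAnabelian

open _root_.CategoryTheory _root_.Quiver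

universe v u w

namespace DiagramOfCategories

variable {V : Type w} [Quiver.{v} V] {D : DiagramOfCategories.{v, u, w} V}
  {C : Type u} [Category.{v} C]

/-! ### Structure functors on extended diagrams -/

/-- Structure functors over `𝒞` on an extended diagram `𝒟 ∪ {v}` (observation and telecore edges),
from structure functors on `𝒟`, a structure functor `N_v` at the new vertex, and isomorphisms
exhibiting the observation / telecore functors as lying over `𝒞`. [folklore] -/
def OverData.extendOver {X : ExtShape.{v} V} (Y : D.ExtData X) (O : D.OverData C) (NS : Y.S ⥤ C)
    (cI : ∀ (a : V) (i : X.I a), Y.obsMap i ⋙ NS ≅ O.N a)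
    (cJ : ∀ (a : V) (j : X.J a), Y.telMap j ⋙ O.N a ≅ NS) : (D.extend Y).OverData C where
  N a := match a with
    | ExtVertex.base a => O.N a
    | ExtVertex.obs => NS
  μ {a b} e := match a, b, e with
    | ExtVertex.base _, ExtVertex.base _, e => O.μ e
    | ExtVertex.base a, ExtVertex.obs, i => cI a i
    | ExtVertex.obs, ExtVertex.base b, j => cJ b j
    | ExtVertex.obs, ExtVertex.obs, e => PEmpty.elim e

section Core

variable (X : ExtShape.{v} V) (hJ : ∀ a, IsEmpty (X.J a)) (Y : D.ExtData X) (O : D.OverData C)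
  (NS : Y.S ⥤ C) (cI : ∀ (a : V) (i : X.I a), Y.obsMap i ⋙ NS ≅ O.N a) (hNS : NS.FullyFaithful)

/-- Structure functors on the observable diagram `𝒮` (no telecore edges). [folklore] -/
def obsOver : (D.extend Y).OverData C :=
  OverData.extendOver Y O NS cI (fun a j => ((hJ a).false j).elim)

/-- Fully faithful structure functor at the observation vertex: `W = {v_𝒮}`. [folklore] -/
def ffObs : ∀ w : X.Vertex, w = X.obs → ((obsOver X hJ Y O NS cI).N w).FullyFaithful :=
  fun _ h => by subst h; exact hNS

/-- **The core family on `𝒮`** determined by the structure functors: the universal family for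
`W = {v_𝒮}`, whose boundary set is the set of ALL co-verticial pairs of paths into `v_𝒮` (Def. 3.5
(iii)). [cite: MochizukiAbsTopIII2015, Definition 3.5 (iii) p.75] -/
noncomputable def univCoreFamily : (D.extend Y).HomotopyFamily :=
  univFamily (obsOver X hJ Y O NS cI) (· = X.obs) (ffObs X hJ Y O NS cI hNS)

/-- Every boundary path of the core family ends at `v_𝒮` (Def. 3.5 (iii) (c)).
[cite: MochizukiAbsTopIII2015, Definition 3.5 (iii) p.75] -/
theorem univCoreFamily_terminal ⦃a b : X.Vertex⦄ ⦃p q : Path a b⦄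
    (h : (univCoreFamily X hJ Y O NS cI hNS).E p q) : b = X.obs := by
  obtain ⟨⟨w, hw, p₁, q₁, s, -, -⟩⟩ := h
  subst hw
  exact eq_of_path_of_isEmpty_hom (ExtShape.isEmpty_hom_obs X hJ) s

/-- **The core observable** `(𝒮, v_𝒮, ℋ)` determined by the structure functors (Def. 3.5 (iii)).
[cite: MochizukiAbsTopIII2015, Definition 3.5 (iii) p.75] -/
noncomputable def univCoreObs : D.Observable where
  shape := X
  isEmpty_J := hJ
  ext := Y
  H := univCoreFamily X hJ Y O NS cI hNS
  terminal_obs := univCoreFamily_terminal X hJ Y O NS cI hNS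

/-- The core observable IS a core as soon as every vertex reaches `v_𝒮` (Def. 3.5 (iii): boundary
set = all co-verticial pairs into `v_𝒮`, and "every vertex of `Γ⃗_𝒟` appears as the initial vertex
of a path … with terminal vertex equal to `v_𝒮`"). [cite: MochizukiAbsTopIII2015, Definition 3.5 (iii) pp.75–76] -/
theorem univCoreObs_isCore (hreach : ∀ a : V, Nonempty (Path (X.base a) X.obs)) :
    (univCoreObs X hJ Y O NS cI hNS).IsCore where
  boundary_all _ p q := ⟨⟨X.obs, rfl, p, q, Path.nil, rfl, rfl⟩⟩
  reaches_obs := hreach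

/-- The core homotopies are the lifts at `v_𝒮` (Rmk. 3.5.1: the "constant portion" under the
diagram). [cite: MochizukiAbsTopIII2015, Remark 3.5.1 p.78] -/
theorem univCoreFamily_η {a : X.Vertex} (p q : Path a X.obs)
    (h : (univCoreFamily X hJ Y O NS cI hNS).E p q) :
    (univCoreFamily X hJ Y O NS cI hNS).η h =
      (obsOver X hJ Y O NS cI).lift (ffObs X hJ Y O NS cI hNS X.obs rfl) p q :=
  univFamily_η_eq_lift (obsOver X hJ Y O NS cI) (· = X.obs) (ffObs X hJ Y O NS cI hNS) rfl p q h

end Core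

/-! ### The telecore over the core -/

section Telecore

variable (X : ExtShape.{v} V) (hJ : ∀ a, IsEmpty (X.J a)) (Y : D.ExtData X) (O : D.OverData C)
  (NS : Y.S ⥤ C) (cI : ∀ (a : V) (i : X.I a), Y.obsMap i ⋙ NS ≅ O.N a) (hNS : NS.FullyFaithful)
  (J : V → Type v) (telMap : ∀ {a : V}, J a → (Y.S ⥤ D.obj a))
  (cJ : ∀ (a : V) (j : J a), telMap j ⋙ O.N a ≅ NS)

/-- The extension data of the telecore diagram `𝒯`: same observation data, telecore functors
`telMap` (Def. 3.5 (iv) (a)). [cite: MochizukiAbsTopIII2015, Definition 3.5 (iv) p.76] -/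
abbrev teleExt : D.ExtData (⟨X.I, J⟩ : ExtShape.{v} V) := ⟨Y.S, Y.obsMap, telMap⟩

/-- Structure functors on the telecore diagram `𝒯`. [folklore] -/
def teleOver : (D.extend (teleExt X Y J telMap)).OverData C :=
  OverData.extendOver (teleExt X Y J telMap) O NS cI cJ

/-- The graph inclusion `Γ⃗_𝒮 ↪ Γ⃗_𝒯`. [cite: MochizukiAbsTopIII2015, Definition 3.5 (iv) p.76] -/
abbrev teleIncl : X.Vertex ⥤q (⟨X.I, J⟩ : ExtShape.{v} V).Vertex := telecoreInclusion X hJ J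

/-- A path of `𝒮` whose image in `𝒯` factors through the observation vertex ENDS there (its image
contains no telecore edge; Def. 3.5 (iii) (b) / (iv) (a)).
[cite: MochizukiAbsTopIII2015, Definition 3.5 (iv) p.76] -/
theorem eq_obs_of_mapPath_eq_comp {a : X.Vertex} :
    ∀ {b : X.Vertex} (p : Path a b) (p₁ : Path ((teleIncl X hJ J).obj a) (ExtShape.obs ⟨X.I, J⟩))
      (r : Path (ExtShape.obs ⟨X.I, J⟩) ((teleIncl X hJ J).obj b)),
      (teleIncl X hJ J).mapPath p = p₁.comp r → b = X.obs := by
  intro b p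
  induction p with
  | nil =>
    intro p₁ r h
    cases a with
    | obs => rfl
    | base w =>
      cases r with
      | cons r' e' => exact absurd h (Path.nil_ne_cons _ _)
  | cons p e ih =>
    intro p₁ r h
    rename_i b' c
    cases c with
    | obs => rfl
    | base w =>
      cases r with
      | cons r' e' =>
        have h' : ((teleIncl X hJ J).mapPath p).cons ((teleIncl X hJ J).map e) = (p₁.comp r').cons e' := h
        have hc := Path.obj_eq_of_cons_eq_cons h'
        subst hc
        have hb' : b' = X.obs := ih p₁ r' (eq_of_heq (Path.heq_of_cons_eq_cons h'))
        subst hb'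
        exact ((hJ w).false e).elim

/-- The observable structure on the shape `X` with EMPTY boundary set (bookkeeping device: it lets
us instantiate `pathFunctor_telecoreInclusion`, which only uses the shape and extension data).
[folklore] -/
private def shapeObs : D.Observable where
  shape := X
  isEmpty_J := hJ
  ext := Y
  H :=
    { E := fun _ _ _ _ => False
      isSaturated :=
        { refl_left := fun _ _ _ _ h => h.elim
          refl_right := fun _ _ _ _ h => h.elim
          trans := fun _ _ _ _ _ h _ => h.elim
          precomp := fun _ _ _ _ _ h _ => h.elim
          postcomp := fun _ _ _ _ _ h _ => h.elim }
      η := fun _ _ _ _ h => h.elim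
      η_refl := fun _ _ _ h => h.elim
      η_trans := fun _ _ _ _ _ h _ => h.elim
      η_whisker := fun _ _ _ _ _ _ h _ _ => h.elim }
  terminal_obs := fun _ _ _ _ h => h.elim

/-- The path functors of `𝒮` and `𝒯` agree along `Γ⃗_𝒮 ↪ Γ⃗_𝒯` (seat abc-iut-L4-t5's
`pathFunctor_telecoreInclusion`, restated for the present extension data; Def. 3.5 (iv) (b)).
[cite: MochizukiAbsTopIII2015, Definition 3.5 (iv) p.76] -/
theorem pathFunctor_heq_teleIncl {a b : X.Vertex} (p : Path a b) :
    (D.extend Y).pathFunctor p ≍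
      (D.extend (teleExt X Y J telMap)).pathFunctor ((teleIncl X hJ J).mapPath p) :=
  pathFunctor_telecoreInclusion D (shapeObs X hJ Y) J telMap p

/-- Bookkeeping: one step of `pathIso` along the inclusion (all functor inputs equal). [folklore] -/
private theorem pathIso_step_heq {A B B' : Type u} [Category.{v} A] [Category.{v} B] [Category.{v} B']
    {K K' : A ⥤ B'} (hK : K = K') {F F' : A ⥤ B} (hF : F = F') (G : B ⥤ B') {NA : A ⥤ C}
    {NB : B ⥤ C} {NB' : B' ⥤ C} (μ : G ⋙ NB' ≅ NB) {I : F ⋙ NB ≅ NA} {I' : F' ⋙ NB ≅ NA}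
    (hI : I ≍ I') (h : K ⋙ NB' = F ⋙ (G ⋙ NB')) (h' : K' ⋙ NB' = F' ⋙ (G ⋙ NB')) :
    (eqToIso h ≪≫ Functor.isoWhiskerLeft F μ ≪≫ I) ≍ (eqToIso h' ≪≫ Functor.isoWhiskerLeft F' μ ≪≫ I') := by
  subst hK hF
  cases hI
  rfl

/-- Bookkeeping: `eqToIso`s out of equal objects are heterogeneously equal. [folklore] -/
private theorem eqToIso_heq {A : Type u} [Category.{v} A] {X X' Y Y' : A ⥤ C} (hX : X = X') (hY : Y = Y')
    (h : X = Y) (h' : X' = Y') : eqToIso h ≍ eqToIso h' := by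
  subst hX hY; rfl

/-- The isomorphisms `pathIso` of `𝒮` and of `𝒯` agree along the graph inclusion `Γ⃗_𝒮 ↪ Γ⃗_𝒯`
(the path functors agree: seat abc-iut-L4-t5's `pathFunctor_telecoreInclusion`; Def. 3.5 (iv) (b)
"`𝒥|_𝒮 = ℋ`" bookkeeping). [cite: MochizukiAbsTopIII2015, Definition 3.5 (iv) p.76] -/
theorem pathIso_heq_telecoreInclusion :
    ∀ {a b : X.Vertex} (p : Path a b),
      (obsOver X hJ Y O NS cI).pathIso p ≍
        (teleOver X Y O NS cI J telMap cJ).pathIso ((teleIncl X hJ J).mapPath p) := by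
  intro a b p
  induction p with
  | nil =>
    have hK : (D.extend Y).pathFunctor (Path.nil : Path a a) ≍
        (D.extend (teleExt X Y J telMap)).pathFunctor (Path.nil : Path ((teleIncl X hJ J).obj a) _) :=
      pathFunctor_heq_teleIncl X hJ Y J telMap (Path.nil : Path a a)
    rw [Prefunctor.mapPath_nil, OverData.pathIso, OverData.pathIso]
    revert hK
    cases a <;>
    · intro hK
      exact eqToIso_heq (congrArg (· ⋙ _) (eq_of_heq hK)) rfl _ _
  | cons p e ih =>
    rename_i c b
    have hF := pathFunctor_heq_teleIncl X hJ Y J telMap p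
    have hK : (D.extend Y).pathFunctor (p.cons e) ≍ (D.extend (teleExt X Y J telMap)).pathFunctor
        (((teleIncl X hJ J).mapPath p).cons ((teleIncl X hJ J).map e)) :=
      pathFunctor_heq_teleIncl X hJ Y J telMap (p.cons e)
    rw [Prefunctor.mapPath_cons, OverData.pathIso, OverData.pathIso]
    revert ih hF hK
    cases a <;> cases c <;> cases b <;>
      first
        | exact (PEmpty.elim e)
        | exact ((hJ _).false e).elim
        | (intro ih hF hK
           exact pathIso_step_heq (eq_of_heq hK) (eq_of_heq hF) _ _ ih _ _)

/-- Bookkeeping: `Iso.hom` respects heterogeneous equality. [folklore] -/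
private theorem iso_hom_heq {A : Type u} [Category.{v} A] {X X' Y Y' : A} (hX : X = X') (hY : Y = Y')
    {I : X ≅ Y} {I' : X' ≅ Y'} (h : I ≍ I') : I.hom ≍ I'.hom := by
  subst hX hY; cases h; rfl

/-- **`𝒥|_𝒮 = ℋ` for the lifts**: the lift at `v_𝒮` of a pair of paths of `𝒮` agrees with the lift
of its image in `𝒯` (Def. 3.5 (iv) (b)). [cite: MochizukiAbsTopIII2015, Definition 3.5 (iv) p.76] -/
theorem lift_heq_telecoreInclusion (hNS' : ((teleOver X Y O NS cI J telMap cJ).N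
      ((teleIncl X hJ J).obj X.obs)).FullyFaithful) {a : X.Vertex} (p q : Path a X.obs) :
    (obsOver X hJ Y O NS cI).lift (ffObs X hJ Y O NS cI hNS X.obs rfl) p q ≍
      (teleOver X Y O NS cI J telMap cJ).lift hNS' ((teleIncl X hJ J).mapPath p)
        ((teleIncl X hJ J).mapPath q) := by
  -- the lift does not depend on the chosen fully faithful structure
  have hirr : (teleOver X Y O NS cI J telMap cJ).lift hNS' ((teleIncl X hJ J).mapPath p)
      ((teleIncl X hJ J).mapPath q) = (teleOver X Y O NS cI J telMap cJ).lift
        (w := (teleIncl X hJ J).obj X.obs) hNS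
        ((teleIncl X hJ J).mapPath p) ((teleIncl X hJ J).mapPath q) :=
    OverData.lift_ext _ (w := (teleIncl X hJ J).obj X.obs) hNS _ (OverData.map_lift_app _ hNS' _ _)
  rw [hirr]
  have hp := pathFunctor_heq_teleIncl X hJ Y J telMap p
  have hq := pathFunctor_heq_teleIncl X hJ Y J telMap q
  have ip := pathIso_heq_telecoreInclusion X hJ Y O NS cI J telMap cJ p
  have iq := pathIso_heq_telecoreInclusion X hJ Y O NS cI J telMap cJ q
  revert hp hq ip iq
  cases a <;>
  · intro hp hq ip iq
    rw [OverData.lift, OverData.lift]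
    exact liftThrough_congr hNS (eq_of_heq hp) (eq_of_heq hq) ip iq

variable (W : (⟨X.I, J⟩ : ExtShape.{v} V).Vertex → Prop)
  (hW : ∀ w, W w → ((teleOver X Y O NS cI J telMap cJ).N w).FullyFaithful)
  (hWobs : W (ExtShape.obs ⟨X.I, J⟩))

/-- **The universal family of the telecore diagram `𝒯`** (fully faithful vertices `W ∋ v_𝒮`).
[cite: MochizukiAbsTopIII2015, Definition 3.5 (ii) p.75] -/
noncomputable def teleUnivFamily : (D.extend (teleExt X Y J telMap)).HomotopyFamily :=
  univFamily (teleOver X Y O NS cI J telMap cJ) W hW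

/-- The universal homotopy of `𝒯` on a pair into a vertex of `W` is the lift there.
[cite: MochizukiAbsTopIII2015, Definition 3.5 (ii) p.75] -/
theorem teleUnivFamily_η_eq_lift {a w : (⟨X.I, J⟩ : ExtShape.{v} V).Vertex} (hw : W w)
    (p q : Path a w) (h : (teleUnivFamily X Y O NS cI J telMap cJ W hW).E p q) :
    (teleUnivFamily X Y O NS cI J telMap cJ W hW).η h =
      (teleOver X Y O NS cI J telMap cJ).lift (hW w hw) p q :=
  univFamily_η_eq_lift _ W hW hw p q h

include hWobs in
/-- The telecore boundary set (Def. 3.5 (iv) (b): pairs `([γ₃]∘[γ₁], [γ₃]∘[γ₂])` with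
`[γ₁], [γ₂]` into `v_𝒮`) lies in `E_W`. [cite: MochizukiAbsTopIII2015, Definition 3.5 (iv) p.76] -/
theorem univE_obs_subset ⦃a b : (⟨X.I, J⟩ : ExtShape.{v} V).Vertex⦄ ⦃p q : Path a b⦄
    (h : univE (· = ExtShape.obs ⟨X.I, J⟩) p q) : (teleUnivFamily X Y O NS cI J telMap cJ W hW).E p q :=
  univE_mono (fun _ hw => hw ▸ hWobs) h

/-- **The telecore family `𝒥`**: the universal family restricted to the pairs
`([γ₃]∘[γ₁], [γ₃]∘[γ₂])` of Def. 3.5 (iv) (b). [cite: MochizukiAbsTopIII2015, Definition 3.5 (iv) p.76] -/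
noncomputable def teleJfam : (D.extend (teleExt X Y J telMap)).HomotopyFamily :=
  (teleUnivFamily X Y O NS cI J telMap cJ W hW).restrictBoundary (univE (· = ExtShape.obs ⟨X.I, J⟩))
    (isSaturated_univE _) (univE_obs_subset X Y O NS cI J telMap cJ W hW hWobs)

/-- **The telecore** `(𝒯, 𝒥)` over the core `(𝒮, v_𝒮, ℋ)` determined by structure functors: telecore
edges `J` with functors `telMap`, family `𝒥 = teleJfam`, and `𝒥|_𝒮 = ℋ` (Def. 3.5 (iv)).
[cite: MochizukiAbsTopIII2015, Definition 3.5 (iv) p.76] -/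
noncomputable def univTelecore (hreach : ∀ a : V, Nonempty (Path (X.base a) X.obs)) :
    D.Telecore (univCoreObs X hJ Y O NS cI hNS) (univCoreObs_isCore X hJ Y O NS cI hNS hreach) where
  J := J
  telMap := telMap
  Jfam := teleJfam X Y O NS cI J telMap cJ W hW hWobs
  boundary_iff _ _ p q := by
    constructor
    · rintro ⟨⟨w, hw, p₁, q₁, r, hp, hq⟩⟩
      subst hw
      exact ⟨p₁, q₁, r, hp, hq⟩
    · rintro ⟨p₁, q₁, r, hp, hq⟩
      exact ⟨⟨_, rfl, p₁, q₁, r, hp, hq⟩⟩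
  pathFunctor_incl _ _ p := pathFunctor_telecoreInclusion D (univCoreObs X hJ Y O NS cI hNS) J telMap p
  restrict_E := by
    intro a b p q
    constructor
    · intro h
      obtain rfl : b = X.obs := univCoreFamily_terminal X hJ Y O NS cI hNS h
      exact ⟨⟨_, rfl, (teleIncl X hJ J).mapPath p, (teleIncl X hJ J).mapPath q, Path.nil, rfl, rfl⟩⟩
    · rintro ⟨⟨w, hw, p₁, q₁, r, hp, -⟩⟩
      subst hw
      obtain rfl : b = X.obs := eq_obs_of_mapPath_eq_comp X hJ J p p₁ r hp
      exact ⟨⟨_, rfl, p, q, Path.nil, rfl, rfl⟩⟩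
  restrict_η := by
    intro a b p q h
    obtain rfl : b = X.obs := univCoreFamily_terminal X hJ Y O NS cI hNS h
    change (univCoreFamily X hJ Y O NS cI hNS).η h ≍
      (teleUnivFamily X Y O NS cI J telMap cJ W hW).η _
    refine (heq_of_eq (univCoreFamily_η X hJ Y O NS cI hNS p q h)).trans ?_
    refine (lift_heq_telecoreInclusion X hJ Y O NS cI hNS J telMap cJ
      (hW _ (hWobs : W ((teleIncl X hJ J).obj X.obs))) p q).trans (heq_of_eq ?_)
    exact (teleUnivFamily_η_eq_lift X Y O NS cI J telMap cJ W hW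
      (hWobs : W ((teleIncl X hJ J).obj X.obs)) _ _ _).symm

/-- Every restriction of the universal family of `𝒯` is a **contact structure** for the telecore
(Def. 3.5 (iv): "compatible with `𝒥`" — both are restrictions of one family).
[cite: MochizukiAbsTopIII2015, Definition 3.5 (iv) p.76] -/
theorem isContactStructure_restrictBoundary (hreach : ∀ a : V, Nonempty (Path (X.base a) X.obs))
    (E' : ∀ ⦃a b : (⟨X.I, J⟩ : ExtShape.{v} V).Vertex⦄, Path a b → Path a b → Prop)
    (hE' : IsSaturated E')
    (hsub : ∀ ⦃a b⦄ ⦃p q : Path a b⦄, E' p q → (teleUnivFamily X Y O NS cI J telMap cJ W hW).E p q) :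
    Telecore.IsContactStructure D (univTelecore X hJ Y O NS cI hNS J telMap cJ W hW hWobs hreach)
      ((teleUnivFamily X Y O NS cI J telMap cJ W hW).restrictBoundary E' hE' hsub) := by
  refine ⟨teleUnivFamily X Y O NS cI J telMap cJ W hW, fun i => ?_⟩
  cases i
  · exact ⟨univE_obs_subset X Y O NS cI J telMap cJ W hW hWobs, fun _ _ _ _ _ => rfl⟩
  · exact ⟨hsub, fun _ _ _ _ _ => rfl⟩

end Telecore

end DiagramOfCategories

end Literature.AnabelianGeometry.AbsoluteAnabelian
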